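import Literature.MathematicalPhysics.QuantumFieldTheory.Balaban1983to89.T4BetaFlowWellPosed

/-!
# EriceRemainderEnclosureHistoryAutonomyMarkovFloor — (E37i) THE FLOOR-USING THRESHOLD IN THE MARKOV SUB-CLASS: for a Markov functional
# `u ↦ φ (u 0)` with floor `b > 0` and Lipschitz constant `L` on ]0,γ], the flow with memory has AT MOST ONE box solution per pin as soon as
# `L < 2·(1∕γ² + b)^{3∕2}` — node U2's floor-free `L·γ³ < 2` (`memFlow_unique_of_shortMemory_markovDegree`) is the case `b = 0` of the bound,
# and in the ratio currency of (E37b)∕(E37h) it reads `L·γ < 3√3·b ⟹ unique` (`2(1+s)^{3∕2}∕s ≥ 3√3` at `s = bγ²`, equality at `s = 2`): the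
# Markov threshold constant is `≥ 3√3 ≈ 5.196` (node U2's bump: `≤ 10`), against `≥ 5∕2` certified for genuine memory by (E37h)

Cell `pub-balaban`, β-function sub-cell, BINDER row D4 «RemainderConst leaves for Bałaban's split» (`HOME/BINDER-OWNERS.md`; owner
lineage `b2b-balaban-beta-an4`; this file by co-owner #2 lineage `b2b-balaban-beta-d4-p2`, generation 39), β-FLOW TEAM duty (1),
FREEZE (0) honoured (def-free; node U2's `MemFlow` ∕ `drive` ∕ `invSq_eq_of_memFlow` ∕ `mul_lower_le_drive` BY NAME).  Companion of (E37g)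
`…HistoryAutonomyDegree` and (E37h) `…HistoryAutonomyConstant`; imports node U2's `T4BetaFlowWellPosed` only.

HONEST FRAMING (page 1, verbatim and binding).  *"Discharging BetaPertH makes Bałaban's UV stability UNCONDITIONAL — a real
constructive-QFT result; it is NOT the continuum limit and NOT the Clay problem."*  THIS FILE DISCHARGES NOTHING OF THE KIND.  Elementary
real analysis about an ABSTRACT Markov functional with displayed floor and Lipschitz constant; whether Bałaban's limit functional is Markov
(Erice's β_n(g²) is, [I]'s (1.22) is not — p. 298) and which constants it has is NOT asserted.  Row D4 class UNCHANGED (critical-path width 0;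
instance 0∕1; D4 DISCHARGE NO DATE).  HONEST DEPENDENCY: continuum YM on T⁴ ⇐ BetaPertH ∧ nine spine estimates (0/9 proved); BetaPertH ⇐
(D1) ∧ (D4) ∧ CAP+tail; G-an2-4 gates asym, D1 and NE2/3/4.

THE POINT.  For a Markov functional the flow is a sequence of DECOUPLED implicit one-step equations `1∕x² − φ x = 1∕y²` (node U2's
`memFlow_unique_of_markov`: uniqueness ⟸ injectivity of `x ↦ 1∕x² − φ x` on the box).  With a floor `b` every solution value from scale 1 on
lies in the SUB-box `x ≤ (1∕γ² + b)^{−1∕2}` (`1∕x² = 1∕y² + φ x ≥ 1∕γ² + b`), where `|1∕x² − 1∕x′²| ≥ 2(1∕γ² + b)^{3∕2}·|x − x′|`; so injectivity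
on that sub-box — `L < 2(1∕γ² + b)^{3∕2}` — suffices (§1 `memFlow_unique_of_markov_floor`).  In the ratio currency: `(3√3·b∕γ)² = 27b²∕γ² ≤
4(1∕γ² + b)³` because `4(1+s)³ − 27s² = (s − 2)²(4s + 1) ≥ 0`, `s = bγ²` (§2 `cubic_27`), hence `L·γ < 3√3·b ⟹ unique`
(`memFlow_unique_of_markov_ratio`).  Census: the floor-using threshold constant is `≥ 3√3` on the Markov sub-class (node U2's bump, ratio 10,
has `s = 2` exactly, where the bound `2(1+s)^{3∕2}∕s` is tightest, `3√3 ≈ 5.196 < 10`), while for genuine memory (E37h) certifies `≥ 5∕2` and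
(E37g) shows degree one in γ — whether memory can push the constant below `3√3` is NOT decided.

WHAT IS PROVED ([folklore]; 0 `def`, 0 sorry).  §1 `inv_sq_sub_inv_sq_ge`, **`memFlow_unique_of_markov_floor`**.  §2 `cubic_27`,
**`memFlow_unique_of_markov_ratio`**, `ratio_ge_of_two_markov_solutions`.
-/

noncomputable section
open Filter Topology Finset

namespace Summit.QuantumFields.BalabanUV.Beta.EriceRemainderEnclosureHistoryAutonomyMarkovFloor

open Literature.MathematicalPhysics.QuantumFieldTheory.Balaban1983to89
open Literature.MathematicalPhysics.QuantumFieldTheory.Balaban1983to89.T4BetaStationary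
open Literature.MathematicalPhysics.QuantumFieldTheory.Balaban1983to89.T4BetaFlowWellPosed

variable {φ : ℝ → ℝ} {L γ b gIR : ℝ} {h h' : ℕ → ℝ}

/-! ## §1 Uniqueness for Markov functionals with a floor: `L < 2(1∕γ² + b)^{3∕2}` -/

/-- On the sub-box `x, x′ ≤ 1∕r` (`r > 0`): `|1∕x² − 1∕x′²| ≥ 2r³·|x − x′|`. [folklore] -/
theorem inv_sq_sub_inv_sq_ge {x x' r : ℝ} (hx : 0 < x) (hx' : 0 < x') (hr : 0 < r) (hxr : x ≤ 1 / r) (hx'r : x' ≤ 1 / r) :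
    2 * r ^ 3 * |x - x'| ≤ |1 / x ^ 2 - 1 / x' ^ 2| := by
  have e : 1 / x ^ 2 - 1 / x' ^ 2 = (x' - x) * ((x + x') / (x ^ 2 * x' ^ 2)) := by field_simp; ring
  have hpos : (0 : ℝ) < (x + x') / (x ^ 2 * x' ^ 2) := by positivity
  rw [e, abs_mul, abs_sub_comm x' x, abs_of_pos hpos, mul_comm (|x - x'|)]
  refine mul_le_mul_of_nonneg_right ?_ (abs_nonneg (x - x'))
  -- 2 r³ ≤ (x + x')/(x² x'²) = 1/(x x'²) + 1/(x² x')
  have h1 : r ≤ 1 / x := by rw [le_one_div hr hx]; exact hxr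
  have h2 : r ≤ 1 / x' := by rw [le_one_div hr hx']; exact hx'r
  have h3 : r ^ 3 ≤ 1 / x * (1 / x') ^ 2 := by
    calc r ^ 3 = r * r ^ 2 := by ring
      _ ≤ 1 / x * (1 / x') ^ 2 := mul_le_mul h1 (pow_le_pow_left₀ hr.le h2 2) (by positivity) (by positivity)
  have h4 : r ^ 3 ≤ (1 / x) ^ 2 * (1 / x') := by
    calc r ^ 3 = r ^ 2 * r := by ring
      _ ≤ (1 / x) ^ 2 * (1 / x') := mul_le_mul (pow_le_pow_left₀ hr.le h1 2) h2 hr.le (by positivity)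
  have e2 : (x + x') / (x ^ 2 * x' ^ 2) = 1 / x * (1 / x') ^ 2 + (1 / x) ^ 2 * (1 / x') := by field_simp
  rw [e2]; linarith

/-- **MARKOV + FLOOR: UNIQUENESS UNDER `L < 2(1∕γ² + b)^{3∕2}`.**  `φ` `L`-Lipschitz on ]0,γ] and `≥ b > 0` there, pin `gIR ∈ ]0,γ]`: two box
solutions of the flow with memory of `u ↦ φ (u 0)` from `gIR` coincide — every solution value from scale 1 on lies in the sub-box
`x ≤ (1∕γ² + b)^{−1∕2}`, where the one-step map `x ↦ 1∕x² − φ x` is injective. [folklore] -/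
theorem memFlow_unique_of_markov_floor
    (hL : ∀ x x', 0 < x → x ≤ γ → 0 < x' → x' ≤ γ → |φ x - φ x'| ≤ L * |x - x'|)
    (hb : 0 < b) (hlo : ∀ x, 0 < x → x ≤ γ → b ≤ φ x) (hgIR : 0 < gIR) (hgIRγ : gIR ≤ γ)
    (hsmall : L < 2 * (1 / γ ^ 2 + b) * Real.sqrt (1 / γ ^ 2 + b))
    (hh : SeqBox γ h) (hh' : SeqBox γ h') (hf : MemFlow (fun u => φ (u 0)) gIR h)
    (hf' : MemFlow (fun u => φ (u 0)) gIR h') : h = h' := by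
  have hγ : 0 < γ := lt_of_lt_of_le hgIR hgIRγ
  set Q : ℝ := 1 / γ ^ 2 + b with hQ
  have hQ0 : 0 < Q := by positivity
  set r : ℝ := Real.sqrt Q with hr
  have hr0 : 0 < r := Real.sqrt_pos.2 hQ0
  have hrQ : r ^ 2 = Q := Real.sq_sqrt hQ0.le
  have hlo' : ∀ u, SeqBox γ u → b ≤ (fun u : ℕ → ℝ => φ (u 0)) u := fun u hu => hlo _ (hu 0).1 (hu 0).2
  -- every solution value from scale 1 on is ≤ 1/r
  have hsub : ∀ {u : ℕ → ℝ}, SeqBox γ u → MemFlow (fun u => φ (u 0)) gIR u → ∀ m, u (m + 1) ≤ 1 / r := by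
    intro u hu hfu m
    have h1 : 1 / gIR ^ 2 + ((m + 1 : ℕ) : ℝ) * b ≤ 1 / u (m + 1) ^ 2 := by
      rw [invSq_eq_of_memFlow hfu (m + 1)]; exact add_le_add le_rfl (mul_lower_le_drive hlo' hu (m + 1))
    have h2 : Q ≤ 1 / u (m + 1) ^ 2 := by
      have hpin : 1 / γ ^ 2 ≤ 1 / gIR ^ 2 := one_div_le_one_div_of_le (by positivity) (pow_le_pow_left₀ hgIR.le hgIRγ 2)
      have hmb : b ≤ ((m + 1 : ℕ) : ℝ) * b := by
        have : (1 : ℝ) ≤ ((m + 1 : ℕ) : ℝ) := by exact_mod_cast Nat.succ_pos m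
        nlinarith
      linarith
    have hu0 := (hu (m + 1)).1
    -- u ≤ 1/r ⟸ (u r)² ≤ 1
    rw [le_div_iff₀ hr0]
    have h3 : (u (m + 1) * r) ^ 2 ≤ 1 := by
      rw [mul_pow, hrQ]
      calc u (m + 1) ^ 2 * Q ≤ u (m + 1) ^ 2 * (1 / u (m + 1) ^ 2) := mul_le_mul_of_nonneg_left h2 (by positivity)
        _ = 1 := by field_simp
    nlinarith [mul_pos hu0 hr0]
  funext m
  induction m with
  | zero => rw [hf.1, hf'.1]
  | succ m ih =>
      have e := hf.2 m
      have e' := hf'.2 m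
      simp only [add_zero] at e e'
      rw [ih] at e
      set x := h (m + 1)
      set x' := h' (m + 1)
      have hx := hh (m + 1)
      have hx' := hh' (m + 1)
      have hdiff : 1 / x ^ 2 - 1 / x' ^ 2 = φ x - φ x' := by linarith
      have hlow := inv_sq_sub_inv_sq_ge hx.1 hx'.1 hr0 (hsub hh hf m) (hsub hh' hf' m)
      rw [hdiff] at hlow
      have hup := hL x x' hx.1 hx.2 hx'.1 hx'.2
      have hQr : 2 * Q * r = 2 * r ^ 3 := by rw [← hrQ]; ring
      have hgap : 0 < 2 * r ^ 3 - L := by linarith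
      have hchain : 2 * r ^ 3 * |x - x'| ≤ L * |x - x'| := hlow.trans hup
      have habs : |x - x'| ≤ 0 := by nlinarith [hchain, hgap, abs_nonneg (x - x')]
      exact eq_of_abs_sub_nonpos habs

/-! ## §2 The ratio form: `L·γ < 3√3·b ⟹ unique` -/

/-- `27·s² ≤ 4·(1 + s)³` for `s ≥ 0` (`4(1+s)³ − 27s² = (s − 2)²(4s + 1)`). [folklore] -/
theorem cubic_27 {s : ℝ} (hs : 0 ≤ s) : 27 * s ^ 2 ≤ 4 * (1 + s) ^ 3 := by
  nlinarith [mul_nonneg (sq_nonneg (s - 2)) (by linarith : (0 : ℝ) ≤ 4 * s + 1)]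

/-- **THE RATIO FORM**: `L·γ < 3√3·b` (with `L ≥ 0`) implies `L < 2(1∕γ² + b)^{3∕2}`, hence uniqueness for Markov functionals with floor `b` —
the Markov sub-class's floor-using threshold constant is at least `3√3 ≈ 5.196` (node U2's bump, ratio `10`, sits at `bγ² = 2`, where the
bound is tightest). [folklore] -/
theorem memFlow_unique_of_markov_ratio
    (hL : ∀ x x', 0 < x → x ≤ γ → 0 < x' → x' ≤ γ → |φ x - φ x'| ≤ L * |x - x'|) (hL0 : 0 ≤ L)
    (hb : 0 < b) (hlo : ∀ x, 0 < x → x ≤ γ → b ≤ φ x) (hgIR : 0 < gIR) (hgIRγ : gIR ≤ γ)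
    (hratio : L * γ < 3 * Real.sqrt 3 * b)
    (hh : SeqBox γ h) (hh' : SeqBox γ h') (hf : MemFlow (fun u => φ (u 0)) gIR h)
    (hf' : MemFlow (fun u => φ (u 0)) gIR h') : h = h' := by
  have hγ : 0 < γ := lt_of_lt_of_le hgIR hgIRγ
  refine memFlow_unique_of_markov_floor hL hb hlo hgIR hgIRγ ?_ hh hh' hf hf'
  set Q : ℝ := 1 / γ ^ 2 + b with hQ
  have hQ0 : 0 < Q := by positivity
  have hsQ : 0 < Real.sqrt Q := Real.sqrt_pos.2 hQ0
  -- compare squares: L² < 27 b²/γ² ≤ 4 Q³ = (2 Q √Q)²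
  have h3 : Real.sqrt 3 ^ 2 = 3 := Real.sq_sqrt (by norm_num)
  have hLγ : (L * γ) ^ 2 < 27 * b ^ 2 := by
    have h0 : 0 ≤ L * γ := by positivity
    have := mul_self_lt_mul_self h0 hratio
    nlinarith [h3]
  have hcub : 27 * b ^ 2 ≤ 4 * Q ^ 3 * γ ^ 2 := by
    have hc := cubic_27 (by positivity : (0 : ℝ) ≤ b * γ ^ 2)
    have e : 4 * Q ^ 3 * γ ^ 2 - 27 * b ^ 2 = (4 * (1 + b * γ ^ 2) ^ 3 - 27 * (b * γ ^ 2) ^ 2) / γ ^ 4 := by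
      rw [hQ]; field_simp
    have h0 : 0 ≤ 4 * Q ^ 3 * γ ^ 2 - 27 * b ^ 2 := by rw [e]; exact div_nonneg (by linarith) (by positivity)
    linarith
  have hsq : L ^ 2 < (2 * Q * Real.sqrt Q) ^ 2 := by
    have e : (2 * Q * Real.sqrt Q) ^ 2 = 4 * Q ^ 3 := by
      rw [show (2 * Q * Real.sqrt Q) ^ 2 = 4 * Q ^ 2 * Real.sqrt Q ^ 2 by ring, Real.sq_sqrt hQ0.le]; ring
    rw [e]
    have : L ^ 2 * γ ^ 2 < 4 * Q ^ 3 * γ ^ 2 := by nlinarith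
    exact lt_of_mul_lt_mul_right this (by positivity)
  exact (pow_lt_pow_iff_left₀ hL0 (by positivity) two_ne_zero).1 hsq

/-- Conversely (contrapositive): two distinct box solutions of a Markov flow with floor `b` force `3√3·b ≤ L·γ`. [folklore] -/
theorem ratio_ge_of_two_markov_solutions
    (hL : ∀ x x', 0 < x → x ≤ γ → 0 < x' → x' ≤ γ → |φ x - φ x'| ≤ L * |x - x'|) (hL0 : 0 ≤ L)
    (hb : 0 < b) (hlo : ∀ x, 0 < x → x ≤ γ → b ≤ φ x) (hgIR : 0 < gIR) (hgIRγ : gIR ≤ γ)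
    (hh : SeqBox γ h) (hh' : SeqBox γ h') (hf : MemFlow (fun u => φ (u 0)) gIR h)
    (hf' : MemFlow (fun u => φ (u 0)) gIR h') (hne : h ≠ h') : 3 * Real.sqrt 3 * b ≤ L * γ :=
  not_lt.1 fun hlt => hne (memFlow_unique_of_markov_ratio hL hL0 hb hlo hgIR hgIRγ hlt hh hh' hf hf')

end Summit.QuantumFields.BalabanUV.Beta.EriceRemainderEnclosureHistoryAutonomyMarkovFloor

end
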